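import Summits.QuantumFields.YangMills.Theses.FemtoCutoffLadder
import Summits.QuantumFields.YangMills.Theorems.FemtoCutoffLadderOneSiteGapUpper
import Summits.QuantumFields.YangMills.Theorems.FemtoCutoffLadderMatchedCouplingExists
import Summits.QuantumFields.YangMills.Theorems.FemtoCutoffLadderAssembly

/-!
# Route `FemtoCutoffLadder` — GLUE item `CoarsePairScalingGlue` (stmt-QuantumFields-23945), PROVED:
# `FixedLatticeLaw → OneSiteGapUpper → CoarsePairScaling`; and the whole route modulo {r2 `UniformStepScaling`, r3-child `FixedLatticeLaw`}

Lead seat `ym-line-fcl-p1` (2026-08-28).  Route rev 4 split crux r3 `CoarsePairScaling` (stmt-QuantumFields-23866) into the crux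
`FixedLatticeLaw` (stmt-QuantumFields-23943 = the tree leaf `FemtoGapFixedLattice` inlined, rfl-equal; OPEN for `L ≥ 2`), the support
`OneSiteGapUpper` (stmt-QuantumFields-23944, closed in `FemtoCutoffLadderOneSiteGapUpper.lean`) and this glue.  Contents:

* §2 the label comparison at EVERY fixed `L` (`bareLambda_le_luscherLambda`, `luscherLambda_sub_bareLambda_le_at`:
  `0 ≤ Λ(β,L) − λ_b(β) ≤ K_L Λ²`, `K_L = 2b₀ log L + (b₁/b₀)(3 − log 2b₀)`; from `Λ³ − λ_b³ = δ_L Λ³λ_b³`, `δ_L λ_b ≤ K_L`) and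
  `fixedLatticeWindowGap_of_fixedLattice` — the fixed-`L` law in window/product currency (verbatim body of the r3 skeleton's
  `FixedLatticeWindowGap`) from the bare-parameter law, default heartbeats;
* §3 `coarsePairScaling_of_parts` (window law ∧ one-site upper ⟹ r3: multiply at matched `Λ`, the `e^{∓ε₁Λ}` cancel),
  ★ `coarsePairScalingGlue_proof : Theses.FemtoCutoffLadder.CoarsePairScalingGlue` (the item, by name),
  `coarsePairScaling_of_fixedLattice : FemtoGapFixedLattice → CoarsePairScaling`, and
  `femtoGapOfRecord_of_uniformStep_of_fixedLattice : UniformStepScaling → FemtoGapFixedLattice → FemtoGapOfRecord` (closed Assembly 23510 +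
  closed anchor 23508 + closed matching 23770): **the route is now exactly {r2 `UniformStepScaling`, tree leaf `FemtoGapFixedLattice`}.**

HONEST FRAMING: `FemtoGapFixedLattice` (second-order toron-valley semiclassics on `SU(2)^{3L³}` at each fixed `L`) is OPEN for `L ≥ 2`
(only `L = 1` = crux ONE is in the tree) and `UniformStepScaling` sits behind the barrier `UVStabilityNonUniqueness`; nothing here
proves either.  R2b1 is a RECORD rung: not infinite volume, not a mass gap, not Clay; no summit is proved by this line.
No definitions, no named facts, no `sorry`.
-/

set_option autoImplicit false

noncomputable section

namespace Summit.QuantumFields.YangMills.Theorems.FemtoCutoffLadder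

open Real
open Summit.QuantumFields.YangMills.Theorems.FemtoTransferGap
open Summit.QuantumFields.YangMills.Theses.FemtoCutoffLadder
open Literature.Analysis.OperatorTheory.YMMatrixModel (luscherEps1)

/-! ## §2 Label comparison at every fixed `L`, and the fixed-lattice law in window form -/

/-- `β/2 − 1/ḡ²(β, L) = 2b₀ log L + (b₁/b₀)(log β − log 2b₀)` (the two-loop deficit of the label at size `L`). [cite: LuscherMunster1984, §2] -/
theorem half_sub_invRunningCoupling {β : ℝ} (hβ : 0 < β) (L : ℕ) :
    β / 2 - invRunningCoupling β L = 2 * b0 * Real.log (L : ℝ) + (b1 / b0) * (Real.log β - Real.log (2 * b0)) := by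
  have hb0 : 0 < b0 := by unfold b0; positivity
  rw [BOHandover.invRunningCoupling_eq, Real.log_div (by positivity) hβ.ne']
  ring

/-- At every lattice size, on the weak-coupling branch: `λ_b(β) ≤ Λ(β, L)` (`1/ḡ² ≤ β/2`, compare cubes). [cite: LuscherMunster1984, §2] -/
theorem bareLambda_le_luscherLambda {β : ℝ} (hβ : 1 ≤ β) (L : ℕ) [NeZero L] (hl : 0 < luscherLambda β L) :
    bareLambda β ≤ luscherLambda β L := by
  have hβ0 : 0 < β := by linarith
  have hv : 0 < invRunningCoupling β L := BOHandover.invRunningCoupling_pos_of_luscherLambda_pos hl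
  have hΛ3 : luscherLambda β L ^ 3 = (invRunningCoupling β L)⁻¹ := BOHandover.luscherLambda_pow_three hv
  have hl3 : bareLambda β ^ 3 = 2 / β := by
    have := bareLambda_cube hβ0
    rw [eq_div_iff hβ0.ne']; linarith
  have hle : invRunningCoupling β L ≤ β / 2 := BOHandover.invRunningCoupling_le_half hβ L
  have hcube : bareLambda β ^ 3 ≤ luscherLambda β L ^ 3 := by
    rw [hΛ3, hl3, show (2 : ℝ) / β = (β / 2)⁻¹ by rw [inv_div]]
    exact inv_anti₀ hv hle
  exact (pow_le_pow_iff_left₀ (bareLambda_pos' hβ0).le hl.le three_ne_zero).mp hcube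

/-- **Label comparison at fixed `L`**: for `β ≥ 1`, `0 < Λ(β,L) ≤ 1`: `Λ(β,L) − λ_b(β) ≤ K_L·Λ(β,L)²`,
`K_L = 2b₀ log L + (b₁/b₀)(3 − log 2b₀)` (`Λ³ − λ_b³ = δ_L Λ³λ_b³`, `δ_L λ_b ≤ K_L`). [cite: LuscherMunster1984, §2] -/
theorem luscherLambda_sub_bareLambda_le_at {β : ℝ} (hβ : 1 ≤ β) (L : ℕ) [NeZero L] (hl : 0 < luscherLambda β L)
    (hl1 : luscherLambda β L ≤ 1) :
    luscherLambda β L - bareLambda β ≤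
      (2 * b0 * Real.log (L : ℝ) + (b1 / b0) * (3 - Real.log (2 * b0))) * luscherLambda β L ^ 2 := by
  have hβ0 : 0 < β := by linarith
  have hb0 : 0 < b0 := by unfold b0; positivity
  have hb1 : 0 < b1 := by unfold b1; positivity
  have hK0 : 0 ≤ b1 / b0 := (div_pos hb1 hb0).le
  have hlogL : 0 ≤ 2 * b0 * Real.log (L : ℝ) := by
    have : 0 ≤ Real.log (L : ℝ) := Real.log_nonneg (by exact_mod_cast NeZero.one_le); positivity
  set Λ : ℝ := luscherLambda β L with hΛ
  set l : ℝ := bareLambda β with hl_def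
  have hlpos : 0 < l := bareLambda_pos' hβ0
  have hlΛ : l ≤ Λ := bareLambda_le_luscherLambda hβ L hl
  have hl1' : l ≤ 1 := hlΛ.trans hl1
  have hv : 0 < invRunningCoupling β L := BOHandover.invRunningCoupling_pos_of_luscherLambda_pos hl
  set v : ℝ := invRunningCoupling β L with hv_def
  have hΛ3 : Λ ^ 3 = v⁻¹ := BOHandover.luscherLambda_pow_three hv
  have hl3 : β * l ^ 3 = 2 := bareLambda_cube hβ0
  set δ : ℝ := β / 2 - v with hδ
  have hδeq : δ = 2 * b0 * Real.log (L : ℝ) + (b1 / b0) * (Real.log β - Real.log (2 * b0)) :=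
    half_sub_invRunningCoupling hβ0 L
  have hlog2b0 : Real.log (2 * b0) ≤ 0 := Real.log_nonpos (by positivity) BOHandover.two_mul_b0_le_one
  have hlogβ : Real.log β ≤ 3 / l := log_le_three_div_bareLambda hβ0
  set K : ℝ := 2 * b0 * Real.log (L : ℝ) + (b1 / b0) * (3 - Real.log (2 * b0)) with hK
  have hKnn : 0 ≤ K := by
    have := anchorK_pos; rw [hK]; linarith
  -- `δ l ≤ K`
  have hδle : δ * l ≤ K := by
    rw [hδeq, hK]
    have h1 : Real.log β * l ≤ 3 := by
      have := mul_le_mul_of_nonneg_right hlogβ hlpos.le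
      rwa [div_mul_cancel₀ _ hlpos.ne'] at this
    have h2 : -Real.log (2 * b0) * l ≤ -Real.log (2 * b0) := by
      have := mul_le_mul_of_nonneg_left hl1' (by linarith : 0 ≤ -Real.log (2 * b0))
      rwa [mul_one] at this
    have h3 : (Real.log β - Real.log (2 * b0)) * l ≤ 3 - Real.log (2 * b0) := by nlinarith
    have h4 : 2 * b0 * Real.log (L : ℝ) * l ≤ 2 * b0 * Real.log (L : ℝ) := by
      have := mul_le_mul_of_nonneg_left hl1' hlogL
      rwa [mul_one] at this
    have h5 : (b1 / b0) * (Real.log β - Real.log (2 * b0)) * l ≤ (b1 / b0) * (3 - Real.log (2 * b0)) := by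
      calc (b1 / b0) * (Real.log β - Real.log (2 * b0)) * l
          = (b1 / b0) * ((Real.log β - Real.log (2 * b0)) * l) := by ring
        _ ≤ (b1 / b0) * (3 - Real.log (2 * b0)) := mul_le_mul_of_nonneg_left h3 hK0
    nlinarith
  -- `Λ³ − l³ = δ Λ³ l³`
  have hcubic : Λ ^ 3 - l ^ 3 = δ * Λ ^ 3 * l ^ 3 := by
    have hl3' : l ^ 3 = 2 / β := by
      rw [eq_div_iff hβ0.ne']; linarith
    rw [hΛ3, hl3', hδ]
    field_simp
  have hΛpos : 0 < Λ := hl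
  have hfactor : (Λ - l) * Λ ^ 2 ≤ Λ ^ 3 - l ^ 3 := by
    have hsub : 0 ≤ Λ - l := by linarith
    nlinarith [mul_nonneg hsub (mul_nonneg hΛpos.le hlpos.le), mul_nonneg hsub (sq_nonneg l)]
  have hΛ2 : 0 < Λ ^ 2 := by positivity
  have hstep : (Λ - l) * Λ ^ 2 ≤ (K * Λ ^ 2) * Λ ^ 2 := by
    calc (Λ - l) * Λ ^ 2 ≤ Λ ^ 3 - l ^ 3 := hfactor
      _ = (δ * l) * (Λ * l ^ 2) * Λ ^ 2 := by rw [hcubic]; ring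
      _ ≤ K * (Λ * l ^ 2) * Λ ^ 2 := by
          apply mul_le_mul_of_nonneg_right _ hΛ2.le
          exact mul_le_mul_of_nonneg_right hδle (by positivity)
      _ ≤ K * Λ ^ 2 * Λ ^ 2 := by
          apply mul_le_mul_of_nonneg_right _ hΛ2.le
          apply mul_le_mul_of_nonneg_left _ hKnn
          nlinarith [mul_le_mul hlΛ hl1' hlpos.le hΛpos.le]
  exact le_of_mul_le_mul_right hstep hΛ2

/-- ★ **The fixed-lattice law in WINDOW form from the tree leaf `FemtoGapFixedLattice`** — verbatim body of the skeleton's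
`FixedLatticeWindowGap`: for every `L` there are `C`, `lam0 > 0` with `λ₁(β,L)^L ≤ e^{−(ε₁Λ − CΛ²)}·λ₀(β,L)^L` on the window of depth
`lam ≤ lam0`.  Raise the bare-parameter law (`β ≥ β₀(L)` deep in the window) to the `L`-th power and convert `λ_b → Λ` by §2.
[cite: Luscher1983, §3] [cite: LuscherMunster1984, §2] -/
theorem fixedLatticeWindowGap_of_fixedLattice (hFL : FemtoGapFixedLattice) :
    ∀ (L : ℕ) [NeZero L], ∃ C lam0 : ℝ, 0 < lam0 ∧ ∀ lam : ℝ, 0 < lam → lam ≤ lam0 → ∀ β : ℝ, InFemtoWindow lam β L →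
      secondValue su2Rep L β ^ L ≤ Real.exp (-(zLower C β L)) * topValue su2Rep L β ^ L := by
  intro L _
  obtain ⟨C, β0, H⟩ := hFL L
  set K : ℝ := 2 * b0 * Real.log (L : ℝ) + (b1 / b0) * (3 - Real.log (2 * b0)) with hK
  set M : ℝ := max β0 1 with hM
  have hM1 : 1 ≤ M := le_max_right _ _
  have hMpos : 0 < M := by linarith
  refine ⟨|luscherEps1| * K + |C|, min (1 / 2) (1 / (4 * M)), lt_min (by norm_num) (by positivity), ?_⟩
  intro lam hlam hle β hW
  have hhalf : lam ≤ 1 / 2 := hle.trans (min_le_left _ _)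
  have hlamM : lam ≤ 1 / (4 * M) := hle.trans (min_le_right _ _)
  have hlam1 : lam ≤ 1 := by linarith
  have hβ1 : 1 ≤ β := hW.1
  have hβ0 : 0 < β := by linarith
  have hβge : β0 ≤ β :=
    ((le_max_left _ _).trans (BOHandover.le_of_small_lam hM1 hlam hlam1 hlamM)).trans
      (BOHandover.beta_ge_of_window (L0 := L) hlam hW)
  have hmain := H β hβge
  -- raise to the `L`-th power
  have hLne : (L : ℝ) ≠ 0 := by exact_mod_cast NeZero.ne L
  have hsec : 0 ≤ secondValue su2Rep L β := (secondValue_su2Rep_pos (L := L) hβ0).le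
  have htop : 0 ≤ topValue su2Rep L β := (topValue_su2Rep_pos L β).le
  have hpow := pow_le_pow_left₀ hsec hmain L
  rw [mul_pow, ← Real.exp_nat_mul, mul_div_cancel₀ _ hLne] at hpow
  -- label conversion in the exponent
  set Λ : ℝ := luscherLambda β L with hΛ
  set l : ℝ := bareLambda β with hl_def
  have hΛpos : 0 < Λ := luscherLambda_pos_of_window hlam hW
  have hΛ1 : Λ ≤ 1 := by have := hW.2.2; linarith
  have hlΛ : l ≤ Λ := bareLambda_le_luscherLambda hβ1 L hΛpos
  have hlpos : 0 < l := bareLambda_pos' hβ0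
  have hdiff : Λ - l ≤ K * Λ ^ 2 := luscherLambda_sub_bareLambda_le_at hβ1 L hΛpos hΛ1
  have hexp : -(luscherEps1 * l - C * l ^ 2) ≤ -(zLower (|luscherEps1| * K + |C|) β L) := by
    have hz : zLower (|luscherEps1| * K + |C|) β L = luscherEps1 * Λ - (|luscherEps1| * K + |C|) * Λ ^ 2 := rfl
    rw [hz]
    have h1 : luscherEps1 * (Λ - l) ≤ |luscherEps1| * (K * Λ ^ 2) := by
      calc luscherEps1 * (Λ - l) ≤ |luscherEps1| * (Λ - l) :=
            mul_le_mul_of_nonneg_right (le_abs_self _) (by linarith)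
        _ ≤ |luscherEps1| * (K * Λ ^ 2) := mul_le_mul_of_nonneg_left hdiff (abs_nonneg _)
    have h2 : C * l ^ 2 ≤ |C| * Λ ^ 2 := by
      calc C * l ^ 2 ≤ |C| * l ^ 2 := mul_le_mul_of_nonneg_right (le_abs_self _) (sq_nonneg _)
        _ ≤ |C| * Λ ^ 2 := mul_le_mul_of_nonneg_left (pow_le_pow_left₀ hlpos.le hlΛ 2) (abs_nonneg _)
    nlinarith
  exact hpow.trans (mul_le_mul_of_nonneg_right (Real.exp_le_exp.mpr hexp) (pow_nonneg htop L))

/-! ## §3 The crux and the leaf from the tree leaf `FemtoGapFixedLattice` -/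

/-- **r3 from its two parts**: the fixed-`L` law in window form and the one-site upper bound give `CoarsePairScaling` (rev 3/4) —
multiply at the matched running parameter (the `e^{∓ε₁Λ}` cancel; constants add). [cite: Luscher1983, §3] -/
theorem coarsePairScaling_of_parts
    (hF : ∀ (L : ℕ) [NeZero L], ∃ C lam0 : ℝ, 0 < lam0 ∧ ∀ lam : ℝ, 0 < lam → lam ≤ lam0 → ∀ β : ℝ, InFemtoWindow lam β L →
      secondValue su2Rep L β ^ L ≤ Real.exp (-(zLower C β L)) * topValue su2Rep L β ^ L)
    (hO : ∃ C lam0 : ℝ, 0 < lam0 ∧ ∀ lam : ℝ, 0 < lam → lam ≤ lam0 → ∀ β : ℝ, InFemtoWindow lam β 1 →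
      Real.exp (-(luscherEps1 * luscherLambda β 1 + C * luscherLambda β 1 ^ 2)) * topValue su2Rep 1 β ≤ secondValue su2Rep 1 β) :
    Summit.QuantumFields.YangMills.Theses.FemtoCutoffLadder.CoarsePairScaling := by
  intro L _
  obtain ⟨C₁, l₁, hl₁, H₁⟩ := hF L
  obtain ⟨C₂, l₂, hl₂, H₂⟩ := hO
  refine ⟨C₁ + C₂, min l₁ l₂, lt_min hl₁ hl₂, ?_⟩
  intro lam hlam hle β β' hw hw' hmatch
  have h1 := H₁ lam hlam (hle.trans (min_le_left _ _)) β hw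
  have h2 := H₂ lam hlam (hle.trans (min_le_right _ _)) β' hw'
  rw [← hmatch] at h2
  set Λ : ℝ := luscherLambda β L with hΛ
  have hbL : 0 ≤ topValue su2Rep L β ^ L := pow_nonneg (topValue_su2Rep_pos L β).le L
  have hb1 : 0 ≤ topValue su2Rep 1 β' := (topValue_su2Rep_pos 1 β').le
  have h2' : topValue su2Rep 1 β' ≤ Real.exp (luscherEps1 * Λ + C₂ * Λ ^ 2) * secondValue su2Rep 1 β' := by
    have := mul_le_mul_of_nonneg_left h2 (Real.exp_pos (luscherEps1 * Λ + C₂ * Λ ^ 2)).le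
    rwa [← mul_assoc, ← Real.exp_add, add_neg_cancel, Real.exp_zero, one_mul] at this
  have hz : -(zLower C₁ β L) = -(luscherEps1 * Λ) + C₁ * Λ ^ 2 := by
    show -(luscherEps1 * Λ - C₁ * Λ ^ 2) = _; ring
  rw [hz] at h1
  calc secondValue su2Rep L β ^ L * topValue su2Rep 1 β'
      ≤ (Real.exp (-(luscherEps1 * Λ) + C₁ * Λ ^ 2) * topValue su2Rep L β ^ L) * topValue su2Rep 1 β' :=
        mul_le_mul_of_nonneg_right h1 hb1
    _ ≤ (Real.exp (-(luscherEps1 * Λ) + C₁ * Λ ^ 2) * topValue su2Rep L β ^ L) *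
          (Real.exp (luscherEps1 * Λ + C₂ * Λ ^ 2) * secondValue su2Rep 1 β') :=
        mul_le_mul_of_nonneg_left h2' (mul_nonneg (Real.exp_pos _).le hbL)
    _ = Real.exp ((C₁ + C₂) * Λ ^ 2) * (secondValue su2Rep 1 β' * topValue su2Rep L β ^ L) := by
        have : Real.exp (-(luscherEps1 * Λ) + C₁ * Λ ^ 2) * Real.exp (luscherEps1 * Λ + C₂ * Λ ^ 2) =
            Real.exp ((C₁ + C₂) * Λ ^ 2) := by
          rw [← Real.exp_add]; congr 1; ring
        rw [← this]; ring

/-- ★ **THE GLUE ITEM `CoarsePairScalingGlue` (stmt-QuantumFields-23945), PROVED**: `FixedLatticeLaw → OneSiteGapUpper → CoarsePairScaling`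
(`FixedLatticeLaw` is rfl-equal to the tree leaf `FemtoGapFixedLattice`, so the window conversion applies to it verbatim). [cite: Luscher1983, §3] -/
theorem coarsePairScalingGlue_proof : Summit.QuantumFields.YangMills.Theses.FemtoCutoffLadder.CoarsePairScalingGlue :=
  fun hFL hO => coarsePairScaling_of_parts (fixedLatticeWindowGap_of_fixedLattice hFL) hO

/-- **Crux r3 from the tree leaf alone: `FemtoGapFixedLattice → CoarsePairScaling`** (the one-site upper part is proved:
`oneSiteGapUpper`). [cite: Luscher1983, §3] -/
theorem coarsePairScaling_of_fixedLattice (hFL : FemtoGapFixedLattice) :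
    Summit.QuantumFields.YangMills.Theses.FemtoCutoffLadder.CoarsePairScaling :=
  coarsePairScaling_of_parts (fixedLatticeWindowGap_of_fixedLattice hFL) oneSiteGapUpper

/-- ★ **The whole route modulo {r2, tree leaf}: `UniformStepScaling → FemtoGapFixedLattice → FemtoGapOfRecord`** — the closed Assembly
(stmt-QuantumFields-23510) fed with r2, `coarsePairScaling_of_fixedLattice`, the closed anchor (23508) and the closed matching (23770).
[cite: LuscherWeiszWolff1991] [cite: Luscher1983, §3] -/
theorem femtoGapOfRecord_of_uniformStep_of_fixedLattice
    (h₁ : Summit.QuantumFields.YangMills.Theses.FemtoCutoffLadder.UniformStepScaling) (hFL : FemtoGapFixedLattice) :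
    FemtoGapOfRecord :=
  assembly_proof h₁ (coarsePairScaling_of_fixedLattice hFL) oneSiteWindowAnchor_proof matchedCouplingExists_proof

end Summit.QuantumFields.YangMills.Theorems.FemtoCutoffLadder

end
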